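/-
Copyright: the b2b-balaban T⁴-continuum CRUX team, row NE7b OWNER lineage `t4-ne7b-p1` (gen 143). Project licence.
-/
import Summits.QuantumFields.BalabanUV.T4Continuum.Spine.NE7b.SupFourthOrderMonomials
import Summits.QuantumFields.BalabanUV.T4Continuum.Spine.NE7b.SupFourthDerivativeRaw

/-!
# THE TILTED CUMULANT CALCULUS, RULES ONE AND TWO (SCOPING (d14)(2)(v) RE-ARCHITECTED, memo SCOPING-d15): the FORM of `∂⁵W` is the
# derivative of (521)'s centred ORDER-4 display along a fifth direction `n`; every term of that display is a tilted mean, covariance, centred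
# third cumulant or `u₄` of POLYNOMIAL observables.  Instead of expanding everything into raw moments (gen 142's 51-letter identity; at order
# five ≈ 250 letters), differentiate CUMULANT BY CUMULANT, once and for all, for ABSTRACT observables `p, q` of (513)'s growth class (`C¹`,
# `|p|, ‖p′‖ ≤ C_p(1+‖U′‖)^{n_p}`): along `ψ_s = ψ₀ + s·n`, with `A = U′(·)n` and `∂p = p′(·)n`,
#   RULE 1  `d∕ds ⟨p⟩ = ⟨∂p⟩ − Cov(p, A)`,
#   RULE 2  `d∕ds Cov(p,q) = Cov(∂p, q) + Cov(p, ∂q) − κ₃(p, q, A)`   (`Cov` in the raw format `Z⁻¹∫epq − Z⁻²∫ep∫eq`, `κ₃` CENTRED),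
# and the growth class is closed under products (`C_{pq} = 2C_pC_q`, `n_{pq} = n_p + n_q`) and contains `A` (`‖n‖(1+κ₂)`, `1`) — so rules 3 and 4
# (`κ₃ ↦ Σκ₃(∂) − u₄`, `u₄ ↦ Σu₄(∂) − u₅`, next files) and the fifteen instantiations give `∂⁵W = ⟨E⟩ − 5Cov(D,A) − 10Cov(C,B) + 10κ₃(C,A,A) +
# 15κ₃(B,B,A) − 10u₄(B,A,A,A) + u₅` by bookkeeping alone (row NE7b, node U5c; (513) `hasFDerivAt_tilted_moment`, `tilted_moment_fderiv_apply`,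
# (518) `integrable_tilted_of_growth`, (516) `hasDerivAt_along_line`, (514) `norm_eval_comp_one_le`, `abs_entry_one_le`, (410) `block_Z_pos` BY
# NAME; [folklore])

Cell `pub-balaban`, sub-cell `t4`, spine estimate NE7b (`T4WeightBudget.RelWeightBound`; the cell's OWN estimate — NOT PRINTED in
[Bałaban 1983–89], NOT PROVED).  Crux-route work under `Spine/NE7b/` by the row OWNER (`t4-ne7b-p1` gen 143, file (581)) under FREEZE
(0)'s crux-prover clause; NOTHING of Bałaban's is named as a Lean object, valued or asserted; no `T4Continuum/Support` leaf typed; no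
`def`, no notation (the class is a conjunction of hypotheses, every cumulant WRITTEN OUT); zero `sorry`.  Imports (BY NAME): the OWNER's (518)
`…SupFourthOrderMonomials` (`integrable_tilted_of_growth`; through it (513), (514)), (516) `…SupFourthDerivativeRaw` (`hasDerivAt_along_line`).

WHAT IS PROVED ([folklore]):
* §1 the class algebra: `class_const_nonneg`, `class_mul_abs_le`, `class_mul_fderiv_le`, `class_mul_fderiv_continuous`, `class_grad_abs_le`,
  `class_grad_fderiv_le`, `class_apply_abs_le`.
* §2 line derivatives: **`hasDerivAt_moment_line`** (`d∕ds ∫ep = ∫e(∂p) − ∫e(pA)`), `hasDerivAt_Z_line` (`d∕ds Z = −∫eA`).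
* §3 **RULE 1 `hasDerivAt_tilted_mean_line`**; §4 `split_centred_triple`, **RULE 2 `hasDerivAt_tilted_cov_line`**; §5 toy.

HONEST (what this is NOT).  Calculus bookkeeping; rules 3–4, the fifteen instantiations on (521)'s display, the FORM of `∂⁵W` and the assembly are
NOT typed here.  Scalar skeleton ((A3), NC-NE7b-α UNRULED); nothing of Bałaban's asserted.  BY-NAME EFFECT ON THE WALL: NONE.  NE7b NOT PRINTED
∕ NOT PROVED; spine PROVED 0∕9; rung (B)+1 — the programme's measures remain FINITE-torus statements; NOT the mass gap, NOT Clay.  HONEST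
DEPENDENCY: continuum YM on T⁴ ⇐ BetaPertH ∧ nine spine estimates (0∕9 proved); BetaPertH ⇐ (D1) ∧ (D4) ∧ CAP+tail; G-an2-4 gates asym, D1 and
NE2∕3∕4.
-/

set_option autoImplicit false
set_option maxSynthPendingDepth 3

noncomputable section

namespace Summit.QuantumFields.BalabanUV.T4Continuum.NE7b.SupTiltedCumulantCalculusOne

open MeasureTheory ProbabilityTheory Real Set Function Finset Matrix
open scoped BigOperators
open SupTiltedScalarMomentCalculus (hasFDerivAt_tilted_moment tilted_moment_fderiv_apply)
open SupFourthOrderMonomials (integrable_tilted_of_growth)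
open SupFourthDerivativeRaw (hasDerivAt_along_line)
open SupTiltedMomentConstituents (norm_eval_comp_one_le abs_entry_one_le)
open SupBlockDressedStep (block_Z_pos)

variable {ι : Type} [Fintype ι] [DecidableEq ι]

variable {Γ : Matrix ι ι ℝ} {γop : ℝ} {U : EuclideanSpace ℝ ι → ℝ} {U' : EuclideanSpace ℝ ι → EuclideanSpace ℝ ι →L[ℝ] ℝ}
  {U'' : EuclideanSpace ℝ ι → EuclideanSpace ℝ ι →L[ℝ] EuclideanSpace ℝ ι →L[ℝ] ℝ} {κ₀ κ₁ κ₂ a τ δ θ : ℝ}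
  {p q : EuclideanSpace ℝ ι → ℝ} {p' q' : EuclideanSpace ℝ ι → EuclideanSpace ℝ ι →L[ℝ] ℝ} {Cp Cq : ℝ} {np nq : ℕ}

/-! ## §1. The growth class: constants, products, the gradient entry, applied derivatives -/

omit [DecidableEq ι] in
/-- A class constant is nonnegative. [folklore] -/
theorem class_const_nonneg (hpb : ∀ φ : EuclideanSpace ℝ ι, |p φ| ≤ Cp * (1 + ‖U' φ‖) ^ np) : 0 ≤ Cp := by
  have h := hpb 0
  have h1 : 0 < (1 + ‖U' 0‖) ^ np := by positivity
  nlinarith [abs_nonneg (p 0)]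

omit [DecidableEq ι] in
/-- **The class is closed under products, values**: `|pq| ≤ 2C_pC_q(1+‖U′‖)^{n_p+n_q}`. [folklore] -/
theorem class_mul_abs_le (hpb : ∀ φ : EuclideanSpace ℝ ι, |p φ| ≤ Cp * (1 + ‖U' φ‖) ^ np) (hqb : ∀ φ : EuclideanSpace ℝ ι, |q φ| ≤ Cq * (1 + ‖U' φ‖)
    ^ nq)
    (φ : EuclideanSpace ℝ ι) : |p φ * q φ| ≤ 2 * Cp * Cq * (1 + ‖U' φ‖) ^ (np + nq) := by
  have hCp := class_const_nonneg hpb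
  have hCq := class_const_nonneg hqb
  rw [abs_mul, pow_add]
  have h := mul_le_mul (hpb φ) (hqb φ) (abs_nonneg _) ((abs_nonneg _).trans (hpb φ))
  have hX : 0 ≤ Cp * (1 + ‖U' φ‖) ^ np * (Cq * (1 + ‖U' φ‖) ^ nq) := by positivity
  nlinarith [h, hX]

omit [DecidableEq ι] in
/-- **The class is closed under products, derivatives**: `‖p•q′ + q•p′‖ ≤ 2C_pC_q(1+‖U′‖)^{n_p+n_q}`. [folklore] -/
theorem class_mul_fderiv_le (hpb : ∀ φ : EuclideanSpace ℝ ι, |p φ| ≤ Cp * (1 + ‖U' φ‖) ^ np)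
    (hp'b : ∀ φ : EuclideanSpace ℝ ι, ‖p' φ‖ ≤ Cp * (1 + ‖U' φ‖) ^ np) (hqb : ∀ φ : EuclideanSpace ℝ ι, |q φ| ≤ Cq * (1 + ‖U' φ‖) ^ nq)
    (hq'b : ∀ φ : EuclideanSpace ℝ ι, ‖q' φ‖ ≤ Cq * (1 + ‖U' φ‖) ^ nq) (φ : EuclideanSpace ℝ ι) :
    ‖p φ • q' φ + q φ • p' φ‖ ≤ 2 * Cp * Cq * (1 + ‖U' φ‖) ^ (np + nq) := by
  have h1 : ‖p φ • q' φ‖ ≤ Cp * (1 + ‖U' φ‖) ^ np * (Cq * (1 + ‖U' φ‖) ^ nq) := by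
    rw [norm_smul, Real.norm_eq_abs]; exact mul_le_mul (hpb φ) (hq'b φ) (norm_nonneg _) ((abs_nonneg _).trans (hpb φ))
  have h2 : ‖q φ • p' φ‖ ≤ Cq * (1 + ‖U' φ‖) ^ nq * (Cp * (1 + ‖U' φ‖) ^ np) := by
    rw [norm_smul, Real.norm_eq_abs]; exact mul_le_mul (hqb φ) (hp'b φ) (norm_nonneg _) ((abs_nonneg _).trans (hqb φ))
  refine (norm_add_le _ _).trans ?_
  rw [pow_add]
  nlinarith [h1, h2]

omit [DecidableEq ι] in
/-- The product's derivative is continuous. [folklore] -/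
theorem class_mul_fderiv_continuous (hp : ∀ φ : EuclideanSpace ℝ ι, HasFDerivAt p (p' φ) φ) (hp'c : Continuous p')
    (hq : ∀ φ : EuclideanSpace ℝ ι, HasFDerivAt q (q' φ) φ) (hq'c : Continuous q') :
    Continuous fun φ : EuclideanSpace ℝ ι => p φ • q' φ + q φ • p' φ := by
  have hpc : Continuous p := continuous_iff_continuousAt.2 fun φ => (hp φ).continuousAt
  have hqc : Continuous q := continuous_iff_continuousAt.2 fun φ => (hq φ).continuousAt
  exact (hpc.smul hq'c).add (hqc.smul hp'c)

omit [DecidableEq ι] in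
/-- **The gradient entry `A = U′(·)n` is in the class**, values: `|U′φ n| ≤ ‖n‖(1+κ₂)(1+‖U′φ‖)¹` (`κ₂ ≥ 0`). [folklore] -/
theorem class_grad_abs_le (hκ₂ : 0 ≤ κ₂) (φ n : EuclideanSpace ℝ ι) : |U' φ n| ≤ ‖n‖ * (1 + κ₂) * (1 + ‖U' φ‖) ^ 1 := by
  rw [pow_one]
  have h0 := abs_entry_one_le (U' φ) n
  have h1 : 0 ≤ ‖n‖ * κ₂ := mul_nonneg (norm_nonneg n) hκ₂
  have h2 : 0 ≤ ‖n‖ * ‖U' φ‖ := mul_nonneg (norm_nonneg n) (norm_nonneg _)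
  nlinarith [norm_nonneg (U' φ), norm_nonneg n, mul_nonneg h1 (norm_nonneg (U' φ))]

omit [DecidableEq ι] in
/-- The gradient entry, derivatives: `‖(ev_n)∘U″φ‖ ≤ ‖n‖(1+κ₂)(1+‖U′φ‖)¹`. [folklore] -/
theorem class_grad_fderiv_le (hU''b : ∀ φ : EuclideanSpace ℝ ι, ‖U'' φ‖ ≤ κ₂) (φ n : EuclideanSpace ℝ ι) :
    ‖(ContinuousLinearMap.apply ℝ ℝ n).comp (U'' φ)‖ ≤ ‖n‖ * (1 + κ₂) * (1 + ‖U' φ‖) ^ 1 := by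
  have hκ₂ : 0 ≤ κ₂ := (norm_nonneg (U'' φ)).trans (hU''b φ)
  rw [pow_one]
  have h0 : ‖(ContinuousLinearMap.apply ℝ ℝ n).comp (U'' φ)‖ ≤ ‖n‖ * κ₂ :=
    (norm_eval_comp_one_le _ _).trans (mul_le_mul_of_nonneg_left (hU''b φ) (norm_nonneg _))
  have h1 : 0 ≤ ‖n‖ * κ₂ := mul_nonneg (norm_nonneg n) hκ₂
  nlinarith [norm_nonneg (U' φ), norm_nonneg n, mul_nonneg h1 (norm_nonneg (U' φ)), mul_nonneg (norm_nonneg n) (norm_nonneg (U' φ))]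

omit [DecidableEq ι] in
/-- **Applied derivatives stay integrable-class**: `|p′φ n| ≤ (‖n‖C_p)(1+‖U′φ‖)^{n_p}`. [folklore] -/
theorem class_apply_abs_le (hp'b : ∀ φ : EuclideanSpace ℝ ι, ‖p' φ‖ ≤ Cp * (1 + ‖U' φ‖) ^ np) (φ n : EuclideanSpace ℝ ι) :
    |p' φ n| ≤ ‖n‖ * Cp * (1 + ‖U' φ‖) ^ np := by
  calc |p' φ n| ≤ ‖p' φ‖ * ‖n‖ := abs_entry_one_le _ _
    _ ≤ Cp * (1 + ‖U' φ‖) ^ np * ‖n‖ := mul_le_mul_of_nonneg_right (hp'b φ) (norm_nonneg _)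
    _ = ‖n‖ * Cp * (1 + ‖U' φ‖) ^ np := by ring

/-! ## §2. Line derivatives of the scalar tilted moments -/

/-- **`d∕ds|₀ ∫e^{−U(ω+ψ_s)}p(ω+ψ_s) = ∫e₀·p′(ω+ψ₀)n − ∫e₀·p(ω+ψ₀)·U′(ω+ψ₀)n`** for `p` in the class. [folklore] -/
theorem hasDerivAt_moment_line (hΓ : Γ.PosSemidef) (hΓop : (γop • (1 : Matrix ι ι ℝ) - Γ).PosSemidef) (Y : Finset ι)
    (hUd : ∀ φ : EuclideanSpace ℝ ι, HasFDerivAt U (U' φ) φ) (hU'd : ∀ φ : EuclideanSpace ℝ ι, HasFDerivAt U' (U'' φ) φ)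
    (hκ₀ : 0 ≤ κ₀) (hκ₁ : 0 ≤ κ₁) (ha : 0 ≤ a) (hτ : 0 < τ) (hδ : 0 < δ) (hθ1 : θ < 1) (hκθ : (2 * κ₀ * (1 + τ) + 4 * δ) * γop ≤ θ)
    (hstab : ∀ φ : EuclideanSpace ℝ ι, -(κ₀ * ∑ x ∈ Y, φ x ^ 2) ≤ U φ) (hU'b : ∀ φ : EuclideanSpace ℝ ι, ‖U' φ‖ ≤ κ₁ * (a + ∑ x ∈ Y, φ x ^ 2))
    (hU''b : ∀ φ : EuclideanSpace ℝ ι, ‖U'' φ‖ ≤ κ₂)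
    (hp : ∀ φ : EuclideanSpace ℝ ι, HasFDerivAt p (p' φ) φ) (hp'c : Continuous p') (hpb : ∀ φ : EuclideanSpace ℝ ι, |p φ| ≤ Cp * (1 + ‖U' φ‖) ^ np)
    (hp'b : ∀ φ : EuclideanSpace ℝ ι, ‖p' φ‖ ≤ Cp * (1 + ‖U' φ‖) ^ np) (ψ₀ n : EuclideanSpace ℝ ι) :
    HasDerivAt (fun s : ℝ => ∫ ω : EuclideanSpace ℝ ι, exp (-U (ω + (ψ₀ + s • n))) * p (ω + (ψ₀ + s • n)) ∂(multivariateGaussian 0 Γ))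
      ((∫ ω : EuclideanSpace ℝ ι, exp (-U (ω + ψ₀)) * p' (ω + ψ₀) n ∂(multivariateGaussian 0 Γ)) -
        (∫ ω : EuclideanSpace ℝ ι, exp (-U (ω + ψ₀)) * (p (ω + ψ₀) * U' (ω + ψ₀) n) ∂(multivariateGaussian 0 Γ))) 0 := by
  have hU'c : Continuous U' := continuous_iff_continuousAt.2 fun φ => (hU'd φ).continuousAt
  have hpc : Continuous p := continuous_iff_continuousAt.2 fun φ => (hp φ).continuousAt
  have hκ₂ : 0 ≤ κ₂ := (norm_nonneg (U'' ψ₀)).trans (hU''b ψ₀)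
  have hF := hasFDerivAt_tilted_moment hΓ hΓop Y hUd hU'c hp hp'c hκ₀ hκ₁ ha hτ hδ hθ1 hκθ hstab hU'b hpb hp'b ψ₀
  have hL := hasDerivAt_along_line hF n
  rw [tilted_moment_fderiv_apply hΓ hΓop Y hUd hU'c hp hp'c hκ₀ hκ₁ ha hτ hδ hθ1 hκθ hstab hU'b hpb hp'b ψ₀ n] at hL
  have i1 := integrable_tilted_of_growth (p := fun φ => p' φ n) hΓ hΓop Y hUd (hp'c.clm_apply continuous_const) hκ₀ hκ₁ ha hτ hδ hθ1 hκθ hstab hU'b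
    (fun φ => class_apply_abs_le hp'b φ n) ψ₀
  have i2 := integrable_tilted_of_growth (p := fun φ => p φ * U' φ n) hΓ hΓop Y hUd (hpc.mul (hU'c.clm_apply continuous_const)) hκ₀ hκ₁ ha hτ hδ hθ1
      hκθ hstab hU'b
    (fun φ => class_mul_abs_le (q := fun φ => U' φ n) hpb (fun φ => class_grad_abs_le hκ₂ φ n) φ) ψ₀
  have e : (∫ ω : EuclideanSpace ℝ ι, exp (-U (ω + ψ₀)) * (p' (ω + ψ₀) n - p (ω + ψ₀) * U' (ω + ψ₀) n) ∂(multivariateGaussian 0 Γ)) =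
      (∫ ω : EuclideanSpace ℝ ι, exp (-U (ω + ψ₀)) * p' (ω + ψ₀) n ∂(multivariateGaussian 0 Γ)) -
        (∫ ω : EuclideanSpace ℝ ι, exp (-U (ω + ψ₀)) * (p (ω + ψ₀) * U' (ω + ψ₀) n) ∂(multivariateGaussian 0 Γ)) := by
    rw [← integral_sub i1 i2]
    exact integral_congr_ae (ae_of_all _ fun ω => by ring)
  rw [e] at hL
  exact hL

/-- **`d∕ds|₀ Z(ψ_s) = −∫e₀·U′(ω+ψ₀)n`** (the observable `1`). [folklore] -/
theorem hasDerivAt_Z_line (hΓ : Γ.PosSemidef) (hΓop : (γop • (1 : Matrix ι ι ℝ) - Γ).PosSemidef) (Y : Finset ι)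
    (hUd : ∀ φ : EuclideanSpace ℝ ι, HasFDerivAt U (U' φ) φ) (hU'd : ∀ φ : EuclideanSpace ℝ ι, HasFDerivAt U' (U'' φ) φ)
    (hκ₀ : 0 ≤ κ₀) (hκ₁ : 0 ≤ κ₁) (ha : 0 ≤ a) (hτ : 0 < τ) (hδ : 0 < δ) (hθ1 : θ < 1) (hκθ : (2 * κ₀ * (1 + τ) + 4 * δ) * γop ≤ θ)
    (hstab : ∀ φ : EuclideanSpace ℝ ι, -(κ₀ * ∑ x ∈ Y, φ x ^ 2) ≤ U φ) (hU'b : ∀ φ : EuclideanSpace ℝ ι, ‖U' φ‖ ≤ κ₁ * (a + ∑ x ∈ Y, φ x ^ 2))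
    (hU''b : ∀ φ : EuclideanSpace ℝ ι, ‖U'' φ‖ ≤ κ₂) (ψ₀ n : EuclideanSpace ℝ ι) :
    HasDerivAt (fun s : ℝ => ∫ ω : EuclideanSpace ℝ ι, exp (-U (ω + (ψ₀ + s • n))) ∂(multivariateGaussian 0 Γ))
      (-(∫ ω : EuclideanSpace ℝ ι, exp (-U (ω + ψ₀)) * U' (ω + ψ₀) n ∂(multivariateGaussian 0 Γ))) 0 := by
  have h := hasDerivAt_moment_line (p := fun _ => (1 : ℝ)) (p' := fun _ => (0 : EuclideanSpace ℝ ι →L[ℝ] ℝ)) (Cp := 1) (np := 0) hΓ hΓop Y hUd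
    hU'd hκ₀ hκ₁ ha hτ hδ hθ1 hκθ hstab hU'b hU''b (fun φ => hasFDerivAt_const (1 : ℝ) φ) continuous_const
    (fun φ => by rw [abs_one, pow_zero, mul_one]) (fun φ => by rw [norm_zero, pow_zero, mul_one]; exact zero_le_one) ψ₀ n
  simp only [mul_one, _root_.zero_apply, mul_zero, integral_zero, one_mul, zero_sub] at h
  exact h

/-! ## §3. RULE 1: the tilted mean -/

/-- **RULE 1 — `d∕ds ⟨p⟩ = ⟨∂p⟩ − Cov(p, A)`** along `ψ_s = ψ₀ + s·n`, `A = U′(·)n`, `∂p = p′(·)n`; `Cov` in the raw format. [folklore] -/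
theorem hasDerivAt_tilted_mean_line (hΓ : Γ.PosSemidef) (hΓop : (γop • (1 : Matrix ι ι ℝ) - Γ).PosSemidef) (Y : Finset ι)
    (hUd : ∀ φ : EuclideanSpace ℝ ι, HasFDerivAt U (U' φ) φ) (hU'd : ∀ φ : EuclideanSpace ℝ ι, HasFDerivAt U' (U'' φ) φ)
    (hκ₀ : 0 ≤ κ₀) (hκ₁ : 0 ≤ κ₁) (ha : 0 ≤ a) (hτ : 0 < τ) (hδ : 0 < δ) (hθ0 : 0 < θ) (hθ1 : θ < 1) (hκθ : (2 * κ₀ * (1 + τ) + 4 * δ) * γop ≤ θ)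
    (hstab : ∀ φ : EuclideanSpace ℝ ι, -(κ₀ * ∑ x ∈ Y, φ x ^ 2) ≤ U φ) (hU'b : ∀ φ : EuclideanSpace ℝ ι, ‖U' φ‖ ≤ κ₁ * (a + ∑ x ∈ Y, φ x ^ 2))
    (hU''b : ∀ φ : EuclideanSpace ℝ ι, ‖U'' φ‖ ≤ κ₂)
    (hp : ∀ φ : EuclideanSpace ℝ ι, HasFDerivAt p (p' φ) φ) (hp'c : Continuous p') (hpb : ∀ φ : EuclideanSpace ℝ ι, |p φ| ≤ Cp * (1 + ‖U' φ‖) ^ np)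
    (hp'b : ∀ φ : EuclideanSpace ℝ ι, ‖p' φ‖ ≤ Cp * (1 + ‖U' φ‖) ^ np) (ψ₀ n : EuclideanSpace ℝ ι) :
    HasDerivAt (fun s : ℝ => (∫ ω : EuclideanSpace ℝ ι, exp (-U (ω + (ψ₀ + s • n))) ∂(multivariateGaussian 0 Γ))⁻¹ * (∫ ω : EuclideanSpace ℝ ι, exp
        (-U (ω + (ψ₀ + s • n))) * p (ω + (ψ₀ + s • n)) ∂(multivariateGaussian 0 Γ)))
      (((∫ ω : EuclideanSpace ℝ ι, exp (-U (ω + ψ₀)) ∂(multivariateGaussian 0 Γ))⁻¹ * (∫ ω : EuclideanSpace ℝ ι, exp (-U (ω + ψ₀)) * p' (ω + ψ₀) n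
          ∂(multivariateGaussian 0 Γ))) - ((∫ ω : EuclideanSpace ℝ ι, exp (-U (ω + ψ₀)) ∂(multivariateGaussian 0 Γ))⁻¹ * (∫ ω : EuclideanSpace ℝ ι,
          exp (-U (ω + ψ₀)) * (p (ω + ψ₀) * U' (ω + ψ₀) n) ∂(multivariateGaussian 0 Γ)) - ((∫ ω : EuclideanSpace ℝ ι, exp (-U (ω + ψ₀))
          ∂(multivariateGaussian 0 Γ)) ^ 2)⁻¹ * ((∫ ω : EuclideanSpace ℝ ι, exp (-U (ω + ψ₀)) * p (ω + ψ₀) ∂(multivariateGaussian 0 Γ)) * (∫ ω :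
          EuclideanSpace ℝ ι, exp (-U (ω + ψ₀)) * U' (ω + ψ₀) n ∂(multivariateGaussian 0 Γ))))) 0 := by
  have hZ := hasDerivAt_Z_line hΓ hΓop Y hUd hU'd hκ₀ hκ₁ ha hτ hδ hθ1 hκθ hstab hU'b hU''b ψ₀ n
  have hM := hasDerivAt_moment_line hΓ hΓop Y hUd hU'd hκ₀ hκ₁ ha hτ hδ hθ1 hκθ hstab hU'b hU''b hp hp'c hpb hp'b ψ₀ n
  have hZ0 : 0 < (∫ ω : EuclideanSpace ℝ ι, exp (-U (ω + ψ₀)) ∂(multivariateGaussian 0 Γ)) := block_Z_pos hΓ hΓop Y hUd hκ₀ hτ hδ hθ0 hθ1 hκθ hstab ψ₀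
  have hz0 : (fun s : ℝ => ∫ ω : EuclideanSpace ℝ ι, exp (-U (ω + (ψ₀ + s • n))) ∂(multivariateGaussian 0 Γ)) 0 ≠ 0 := by
    simp only [zero_smul, add_zero]; exact ne_of_gt hZ0
  have h := (hZ.inv hz0).mul hM
  simp only [Pi.inv_apply, zero_smul, add_zero] at h
  refine h.congr_deriv ?_
  field_simp
  ring

/-! ## §4. RULE 2: the covariance (raw format), the third cumulant CENTRED -/

/-- **Splitting a centred triple**: `∫e(f−a)(g−b)(h−c) = ∫efgh − a∫egh − b∫efh − c∫efg + ab∫eh + ac∫eg + bc∫ef − abc·Z` for continuous class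
observables `f, g, h`. [folklore] -/
theorem split_centred_triple {f g h : EuclideanSpace ℝ ι → ℝ} {Cf Cg Ch : ℝ} {nf ng nh : ℕ} (hΓ : Γ.PosSemidef)
    (hΓop : (γop • (1 : Matrix ι ι ℝ) - Γ).PosSemidef) (Y : Finset ι) (hUd : ∀ φ : EuclideanSpace ℝ ι, HasFDerivAt U (U' φ) φ)
    (hκ₀ : 0 ≤ κ₀) (hκ₁ : 0 ≤ κ₁) (ha : 0 ≤ a) (hτ : 0 < τ) (hδ : 0 < δ) (hθ1 : θ < 1) (hκθ : (2 * κ₀ * (1 + τ) + 4 * δ) * γop ≤ θ)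
    (hstab : ∀ φ : EuclideanSpace ℝ ι, -(κ₀ * ∑ x ∈ Y, φ x ^ 2) ≤ U φ) (hU'b : ∀ φ : EuclideanSpace ℝ ι, ‖U' φ‖ ≤ κ₁ * (a + ∑ x ∈ Y, φ x ^ 2))
    (hfc : Continuous f) (hgc : Continuous g) (hhc : Continuous h)
    (hfb : ∀ φ : EuclideanSpace ℝ ι, |f φ| ≤ Cf * (1 + ‖U' φ‖) ^ nf) (hgb : ∀ φ : EuclideanSpace ℝ ι, |g φ| ≤ Cg * (1 + ‖U' φ‖) ^ ng)
    (hhb : ∀ φ : EuclideanSpace ℝ ι, |h φ| ≤ Ch * (1 + ‖U' φ‖) ^ nh) (ψ : EuclideanSpace ℝ ι) (ca cb cc : ℝ) :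
    (∫ ω : EuclideanSpace ℝ ι, exp (-U (ω + ψ)) * ((f (ω + ψ) - ca) * (g (ω + ψ) - cb) * (h (ω + ψ) - cc)) ∂(multivariateGaussian 0 Γ)) =
      (∫ ω : EuclideanSpace ℝ ι, exp (-U (ω + ψ)) * (f (ω + ψ) * g (ω + ψ) * h (ω + ψ)) ∂(multivariateGaussian 0 Γ)) -
        ca * (∫ ω : EuclideanSpace ℝ ι, exp (-U (ω + ψ)) * (g (ω + ψ) * h (ω + ψ)) ∂(multivariateGaussian 0 Γ)) -
        cb * (∫ ω : EuclideanSpace ℝ ι, exp (-U (ω + ψ)) * (f (ω + ψ) * h (ω + ψ)) ∂(multivariateGaussian 0 Γ)) -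
        cc * (∫ ω : EuclideanSpace ℝ ι, exp (-U (ω + ψ)) * (f (ω + ψ) * g (ω + ψ)) ∂(multivariateGaussian 0 Γ)) +
        ca * cb * (∫ ω : EuclideanSpace ℝ ι, exp (-U (ω + ψ)) * h (ω + ψ) ∂(multivariateGaussian 0 Γ)) +
        ca * cc * (∫ ω : EuclideanSpace ℝ ι, exp (-U (ω + ψ)) * g (ω + ψ) ∂(multivariateGaussian 0 Γ)) +
        cb * cc * (∫ ω : EuclideanSpace ℝ ι, exp (-U (ω + ψ)) * f (ω + ψ) ∂(multivariateGaussian 0 Γ)) -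
        ca * cb * cc * (∫ ω : EuclideanSpace ℝ ι, exp (-U (ω + ψ)) ∂(multivariateGaussian 0 Γ)) := by
  have ifgh := integrable_tilted_of_growth (p := fun φ => f φ * g φ * h φ) hΓ hΓop Y hUd ((hfc.mul hgc).mul hhc) hκ₀ hκ₁ ha hτ hδ hθ1 hκθ hstab hU'b
    (fun φ => class_mul_abs_le (fun φ => class_mul_abs_le hfb hgb φ) hhb φ) ψ
  have igh := integrable_tilted_of_growth (p := fun φ => g φ * h φ) hΓ hΓop Y hUd (hgc.mul hhc) hκ₀ hκ₁ ha hτ hδ hθ1 hκθ hstab hU'b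
    (fun φ => class_mul_abs_le hgb hhb φ) ψ
  have ifh := integrable_tilted_of_growth (p := fun φ => f φ * h φ) hΓ hΓop Y hUd (hfc.mul hhc) hκ₀ hκ₁ ha hτ hδ hθ1 hκθ hstab hU'b
    (fun φ => class_mul_abs_le hfb hhb φ) ψ
  have ifg := integrable_tilted_of_growth (p := fun φ => f φ * g φ) hΓ hΓop Y hUd (hfc.mul hgc) hκ₀ hκ₁ ha hτ hδ hθ1 hκθ hstab hU'b
    (fun φ => class_mul_abs_le hfb hgb φ) ψ
  have i_f := integrable_tilted_of_growth hΓ hΓop Y hUd hfc hκ₀ hκ₁ ha hτ hδ hθ1 hκθ hstab hU'b hfb ψ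
  have i_g := integrable_tilted_of_growth hΓ hΓop Y hUd hgc hκ₀ hκ₁ ha hτ hδ hθ1 hκθ hstab hU'b hgb ψ
  have i_h := integrable_tilted_of_growth hΓ hΓop Y hUd hhc hκ₀ hκ₁ ha hτ hδ hθ1 hκθ hstab hU'b hhb ψ
  have i_1 : Integrable (fun ω : EuclideanSpace ℝ ι => exp (-U (ω + ψ))) (multivariateGaussian 0 Γ) := by
    have h1 := integrable_tilted_of_growth (p := fun _ => (1 : ℝ)) (Cp := 1) (n := 0) hΓ hΓop Y hUd continuous_const hκ₀ hκ₁ ha hτ hδ hθ1 hκθ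
      hstab hU'b (fun φ => by rw [abs_one, pow_zero, mul_one]) ψ
    simpa only [mul_one] using h1
  have e : ∀ ω : EuclideanSpace ℝ ι, exp (-U (ω + ψ)) * ((f (ω + ψ) - ca) * (g (ω + ψ) - cb) * (h (ω + ψ) - cc)) =
      exp (-U (ω + ψ)) * (f (ω + ψ) * g (ω + ψ) * h (ω + ψ)) - ca * (exp (-U (ω + ψ)) * (g (ω + ψ) * h (ω + ψ))) -
        cb * (exp (-U (ω + ψ)) * (f (ω + ψ) * h (ω + ψ))) - cc * (exp (-U (ω + ψ)) * (f (ω + ψ) * g (ω + ψ))) +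
        ca * cb * (exp (-U (ω + ψ)) * h (ω + ψ)) + ca * cc * (exp (-U (ω + ψ)) * g (ω + ψ)) + cb * cc * (exp (-U (ω + ψ)) * f (ω + ψ)) -
        ca * cb * cc * exp (-U (ω + ψ)) := fun ω => by ring
  simp_rw [e]
  rw [integral_sub, integral_add, integral_add, integral_add, integral_sub, integral_sub, integral_sub, integral_const_mul, integral_const_mul,
    integral_const_mul, integral_const_mul, integral_const_mul, integral_const_mul, integral_const_mul]
  · exact ifgh
  · exact igh.const_mul _
  · exact ifgh.sub (igh.const_mul _)
  · exact ifh.const_mul _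
  · exact (ifgh.sub (igh.const_mul _)).sub (ifh.const_mul _)
  · exact ifg.const_mul _
  · exact ((ifgh.sub (igh.const_mul _)).sub (ifh.const_mul _)).sub (ifg.const_mul _)
  · exact i_h.const_mul _
  · exact (((ifgh.sub (igh.const_mul _)).sub (ifh.const_mul _)).sub (ifg.const_mul _)).add (i_h.const_mul _)
  · exact i_g.const_mul _
  · exact ((((ifgh.sub (igh.const_mul _)).sub (ifh.const_mul _)).sub (ifg.const_mul _)).add (i_h.const_mul _)).add (i_g.const_mul _)
  · exact i_f.const_mul _
  · exact (((((ifgh.sub (igh.const_mul _)).sub (ifh.const_mul _)).sub (ifg.const_mul _)).add (i_h.const_mul _)).add (i_g.const_mul _)).add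
      (i_f.const_mul _)
  · exact i_1.const_mul _

/-- **RULE 2 — `d∕ds Cov(p,q) = Cov(∂p, q) + Cov(p, ∂q) − κ₃(p, q, A)`** along `ψ_s = ψ₀ + s·n` (`Cov` raw, `κ₃` CENTRED with the tilted means as
centring constants). [folklore] -/
theorem hasDerivAt_tilted_cov_line (hΓ : Γ.PosSemidef) (hΓop : (γop • (1 : Matrix ι ι ℝ) - Γ).PosSemidef) (Y : Finset ι)
    (hUd : ∀ φ : EuclideanSpace ℝ ι, HasFDerivAt U (U' φ) φ) (hU'd : ∀ φ : EuclideanSpace ℝ ι, HasFDerivAt U' (U'' φ) φ)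
    (hκ₀ : 0 ≤ κ₀) (hκ₁ : 0 ≤ κ₁) (ha : 0 ≤ a) (hτ : 0 < τ) (hδ : 0 < δ) (hθ0 : 0 < θ) (hθ1 : θ < 1) (hκθ : (2 * κ₀ * (1 + τ) + 4 * δ) * γop ≤ θ)
    (hstab : ∀ φ : EuclideanSpace ℝ ι, -(κ₀ * ∑ x ∈ Y, φ x ^ 2) ≤ U φ) (hU'b : ∀ φ : EuclideanSpace ℝ ι, ‖U' φ‖ ≤ κ₁ * (a + ∑ x ∈ Y, φ x ^ 2))
    (hU''b : ∀ φ : EuclideanSpace ℝ ι, ‖U'' φ‖ ≤ κ₂)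
    (hp : ∀ φ : EuclideanSpace ℝ ι, HasFDerivAt p (p' φ) φ) (hp'c : Continuous p') (hpb : ∀ φ : EuclideanSpace ℝ ι, |p φ| ≤ Cp * (1 + ‖U' φ‖) ^ np)
    (hp'b : ∀ φ : EuclideanSpace ℝ ι, ‖p' φ‖ ≤ Cp * (1 + ‖U' φ‖) ^ np)
    (hq : ∀ φ : EuclideanSpace ℝ ι, HasFDerivAt q (q' φ) φ) (hq'c : Continuous q') (hqb : ∀ φ : EuclideanSpace ℝ ι, |q φ| ≤ Cq * (1 + ‖U' φ‖) ^ nq)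
    (hq'b : ∀ φ : EuclideanSpace ℝ ι, ‖q' φ‖ ≤ Cq * (1 + ‖U' φ‖) ^ nq) (ψ₀ n : EuclideanSpace ℝ ι) :
    HasDerivAt (fun s : ℝ => (∫ ω : EuclideanSpace ℝ ι, exp (-U (ω + (ψ₀ + s • n))) ∂(multivariateGaussian 0 Γ))⁻¹ * (∫ ω : EuclideanSpace ℝ ι, exp
        (-U (ω + (ψ₀ + s • n))) * (p (ω + (ψ₀ + s • n)) * q (ω + (ψ₀ + s • n))) ∂(multivariateGaussian 0 Γ)) -
        ((∫ ω : EuclideanSpace ℝ ι, exp (-U (ω + (ψ₀ + s • n))) ∂(multivariateGaussian 0 Γ)) ^ 2)⁻¹ * ((∫ ω : EuclideanSpace ℝ ι, exp (-U (ω + (ψ₀ +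
            s • n))) * p (ω + (ψ₀ + s • n)) ∂(multivariateGaussian 0 Γ)) * (∫ ω : EuclideanSpace ℝ ι, exp (-U (ω + (ψ₀ + s • n))) * q (ω + (ψ₀ + s •
            n)) ∂(multivariateGaussian 0 Γ))))
      (((∫ ω : EuclideanSpace ℝ ι, exp (-U (ω + ψ₀)) ∂(multivariateGaussian 0 Γ))⁻¹ * (∫ ω : EuclideanSpace ℝ ι, exp (-U (ω + ψ₀)) * (p' (ω + ψ₀) n *
          q (ω + ψ₀)) ∂(multivariateGaussian 0 Γ)) - ((∫ ω : EuclideanSpace ℝ ι, exp (-U (ω + ψ₀)) ∂(multivariateGaussian 0 Γ)) ^ 2)⁻¹ * ((∫ ω :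
          EuclideanSpace ℝ ι, exp (-U (ω + ψ₀)) * p' (ω + ψ₀) n ∂(multivariateGaussian 0 Γ)) * (∫ ω : EuclideanSpace ℝ ι, exp (-U (ω + ψ₀)) * q (ω +
          ψ₀) ∂(multivariateGaussian 0 Γ)))) +
        ((∫ ω : EuclideanSpace ℝ ι, exp (-U (ω + ψ₀)) ∂(multivariateGaussian 0 Γ))⁻¹ * (∫ ω : EuclideanSpace ℝ ι, exp (-U (ω + ψ₀)) * (p (ω + ψ₀) *
            q' (ω + ψ₀) n) ∂(multivariateGaussian 0 Γ)) - ((∫ ω : EuclideanSpace ℝ ι, exp (-U (ω + ψ₀)) ∂(multivariateGaussian 0 Γ)) ^ 2)⁻¹ * ((∫ ω :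
            EuclideanSpace ℝ ι, exp (-U (ω + ψ₀)) * p (ω + ψ₀) ∂(multivariateGaussian 0 Γ)) * (∫ ω : EuclideanSpace ℝ ι, exp (-U (ω + ψ₀)) * q' (ω +
            ψ₀) n ∂(multivariateGaussian 0 Γ)))) -
        ((∫ ω : EuclideanSpace ℝ ι, exp (-U (ω + ψ₀)) ∂(multivariateGaussian 0 Γ))⁻¹ * (∫ ω : EuclideanSpace ℝ ι, exp (-U (ω + ψ₀)) * ((p (ω + ψ₀) -
            ((∫ ω : EuclideanSpace ℝ ι, exp (-U (ω + ψ₀)) ∂(multivariateGaussian 0 Γ))⁻¹ * (∫ ω : EuclideanSpace ℝ ι, exp (-U (ω + ψ₀)) * p (ω + ψ₀)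
            ∂(multivariateGaussian 0 Γ)))) * (q (ω + ψ₀) - ((∫ ω : EuclideanSpace ℝ ι, exp (-U (ω + ψ₀)) ∂(multivariateGaussian 0 Γ))⁻¹ * (∫ ω :
            EuclideanSpace ℝ ι, exp (-U (ω + ψ₀)) * q (ω + ψ₀) ∂(multivariateGaussian 0 Γ)))) * (U' (ω + ψ₀) n - ((∫ ω : EuclideanSpace ℝ ι, exp (-U
            (ω + ψ₀)) ∂(multivariateGaussian 0 Γ))⁻¹ * (∫ ω : EuclideanSpace ℝ ι, exp (-U (ω + ψ₀)) * U' (ω + ψ₀) n ∂(multivariateGaussian 0 Γ)))))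
            ∂(multivariateGaussian 0 Γ)))) 0 := by
  have hU'c : Continuous U' := continuous_iff_continuousAt.2 fun φ => (hU'd φ).continuousAt
  have hpc : Continuous p := continuous_iff_continuousAt.2 fun φ => (hp φ).continuousAt
  have hqc : Continuous q := continuous_iff_continuousAt.2 fun φ => (hq φ).continuousAt
  have hκ₂ : 0 ≤ κ₂ := (norm_nonneg (U'' ψ₀)).trans (hU''b ψ₀)
  have hZ0 : 0 < (∫ ω : EuclideanSpace ℝ ι, exp (-U (ω + ψ₀)) ∂(multivariateGaussian 0 Γ)) := block_Z_pos hΓ hΓop Y hUd hκ₀ hτ hδ hθ0 hθ1 hκθ hstab ψ₀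
  -- the four line derivatives: `Z`, `∫ep`, `∫eq`, `∫epq`
  have hZ := hasDerivAt_Z_line hΓ hΓop Y hUd hU'd hκ₀ hκ₁ ha hτ hδ hθ1 hκθ hstab hU'b hU''b ψ₀ n
  have hMp := hasDerivAt_moment_line hΓ hΓop Y hUd hU'd hκ₀ hκ₁ ha hτ hδ hθ1 hκθ hstab hU'b hU''b hp hp'c hpb hp'b ψ₀ n
  have hMq := hasDerivAt_moment_line hΓ hΓop Y hUd hU'd hκ₀ hκ₁ ha hτ hδ hθ1 hκθ hstab hU'b hU''b hq hq'c hqb hq'b ψ₀ n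
  have hMpq := hasDerivAt_moment_line (p := fun φ => p φ * q φ) (p' := fun φ => p φ • q' φ + q φ • p' φ) (Cp := 2 * Cp * Cq) (np := np + nq) hΓ
    hΓop Y hUd hU'd hκ₀ hκ₁ ha hτ hδ hθ1 hκθ hstab hU'b hU''b (fun φ => (hp φ).mul (hq φ)) (class_mul_fderiv_continuous hp hp'c hq hq'c)
    (fun φ => class_mul_abs_le hpb hqb φ) (fun φ => class_mul_fderiv_le hpb hp'b hqb hq'b φ) ψ₀ n
  -- split `∫e·((p•q′ + q•p′) n)` into `∫e(p′n·q) + ∫e(p·q′n)`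
  have ip'q := integrable_tilted_of_growth (p := fun φ => p' φ n * q φ) hΓ hΓop Y hUd ((hp'c.clm_apply continuous_const).mul hqc) hκ₀ hκ₁ ha hτ hδ
      hθ1 hκθ hstab hU'b
    (fun φ => class_mul_abs_le (fun φ => class_apply_abs_le hp'b φ n) hqb φ) ψ₀
  have ipq' := integrable_tilted_of_growth (p := fun φ => p φ * q' φ n) hΓ hΓop Y hUd (hpc.mul (hq'c.clm_apply continuous_const)) hκ₀ hκ₁ ha hτ hδ
      hθ1 hκθ hstab hU'b
    (fun φ => class_mul_abs_le hpb (fun φ => class_apply_abs_le hq'b φ n) φ) ψ₀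
  have esplit : (∫ ω : EuclideanSpace ℝ ι, exp (-U (ω + ψ₀)) * (p (ω + ψ₀) • q' (ω + ψ₀) + q (ω + ψ₀) • p' (ω + ψ₀)) n ∂(multivariateGaussian 0 Γ)) =
      (∫ ω : EuclideanSpace ℝ ι, exp (-U (ω + ψ₀)) * (p' (ω + ψ₀) n * q (ω + ψ₀)) ∂(multivariateGaussian 0 Γ)) +
        (∫ ω : EuclideanSpace ℝ ι, exp (-U (ω + ψ₀)) * (p (ω + ψ₀) * q' (ω + ψ₀) n) ∂(multivariateGaussian 0 Γ)) := by
    rw [← integral_add ip'q ipq']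
    refine integral_congr_ae (ae_of_all _ fun ω => ?_)
    simp only [_root_.add_apply, _root_.smul_apply, smul_eq_mul]
    ring
  rw [esplit] at hMpq
  -- the centred third cumulant split into raw moments
  rw [split_centred_triple (f := p) (g := q) (h := fun φ => U' φ n) hΓ hΓop Y hUd hκ₀ hκ₁ ha hτ hδ hθ1 hκθ hstab hU'b hpc hqc
    (hU'c.clm_apply continuous_const) hpb hqb (fun φ => class_grad_abs_le hκ₂ φ n) ψ₀]
  have hz0 : (fun s : ℝ => ∫ ω : EuclideanSpace ℝ ι, exp (-U (ω + (ψ₀ + s • n))) ∂(multivariateGaussian 0 Γ)) 0 ≠ 0 := by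
    simp only [zero_smul, add_zero]; exact ne_of_gt hZ0
  have hz2 : (fun s : ℝ => (∫ ω : EuclideanSpace ℝ ι, exp (-U (ω + (ψ₀ + s • n))) ∂(multivariateGaussian 0 Γ)) ^ 2) 0 ≠ 0 := by
    simp only [zero_smul, add_zero]; exact pow_ne_zero 2 (ne_of_gt hZ0)
  have h := ((hZ.inv hz0).mul hMpq).sub (((hZ.pow 2).inv hz2).mul (hMp.mul hMq))
  simp only [Pi.inv_apply, Pi.mul_apply, Pi.pow_apply, zero_smul, add_zero] at h
  refine h.congr_deriv ?_
  field_simp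
  ring

/-! ## §5. Toy -/

/-- Toy (the class constant of a product in numbers): `|1·1| ≤ 2·1·1·(1+0)^{0+0}`. -/
example : |(1 : ℝ) * 1| ≤ 2 * 1 * 1 * (1 + 0) ^ (0 + 0) := by norm_num

end Summit.QuantumFields.BalabanUV.T4Continuum.NE7b.SupTiltedCumulantCalculusOne

end
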